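import Summits.HubbardSuperconductivity.HubbardSuperconductivity.Theorems.AnisotropyChordTransferFibre3TwoChannel

/-!
# Route `AnisotropyChord` / H0 rotor rung: PartN40 — the 2×2 COMPRESSION BOUND, PROVED

PORT PartN40 (`…Fibre3TwoChannel`, theory seat `hubbard-h0-rotor-theory-1` g21, memo 21 §327(e)) types
`TwoChannel.CompressionBound : Prop` — the load-bearing glue of THEOREM H2F: for a symmetric `4 × 4` matrix `P`,
`ρ ≥ 0`, a vector `x`, the unit vector `u = 1_B/2`, `η = ⟨u,Pu⟩`, `‖Pu − ηu‖ ≤ res`, `P ≥ g` on `u^⊥`,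
`a = ⟨u,x⟩`, `‖x − au‖ = xp`:
`P + ρ x xᵀ ⪰ λ₋ := ½[(η + ρa² + g) − √((η + ρa² − g)² + 4(ρ|a|·xp + res)²)]`.
This file proves it (`compressionBound_holds`).  Proof (pure linear algebra): split `v = αu + w`, `w ⊥ u`;
`⟨v,Pv⟩ = α²η + 2α⟨w, Pu − ηu⟩ + ⟨w,Pw⟩` (symmetry), `⟨x,v⟩ = aα + ⟨x − au, w⟩`; Cauchy–Schwarz on the two cross
terms and `⟨w,Pw⟩ ≥ g‖w‖²` give `≥ (η + ρa²)α² + g‖w‖² − 2|α|‖w‖(res + ρ|a|xp)`, and the `2 × 2` matrix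
`[[A, −B], [−B, g]]` is `⪰ λ₋` (`(A − λ₋)(g − λ₋) = B²`, both factors `≥ 0`).
Prover seat `hubbard-h0-rotor-p2` g0; helper for stmt-HubbardSuperconductivity-19089 (`--supports`, helper class).
WHAT THIS IS NOT: nothing here proves superconductivity in the Hubbard model; helper algebra of ONE conditional reduction
(rung 19089, HOLE₂(.75) far pairs, THEOREM H2F).  Mathlib only; no sorry, no axioms.
-/

set_option linter.dupNamespace false
namespace Summit.HubbardSuperconductivity.HubbardSuperconductivity.Theorems.AnisotropyChord.Transfer.Fibre3

namespace TwoChannel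

open Matrix

/-- the `2 × 2` eigenvalue bound: `[[A, −B], [−B, g]] ⪰ λ₋ = ((A+g) − √((A−g)² + 4B²))/2`, as a quadratic-form
inequality `λ₋ (s² + t²) ≤ A s² + g t² − 2B s t`. -/
theorem two_by_two_lower (A g B s t : ℝ) :
    ((A + g) - Real.sqrt ((A - g) ^ 2 + 4 * B ^ 2)) / 2 * (s ^ 2 + t ^ 2) ≤ A * s ^ 2 + g * t ^ 2 - 2 * B * s * t := by
  set D := (A - g) ^ 2 + 4 * B ^ 2 with hD
  have hD0 : 0 ≤ D := by positivity
  set S := Real.sqrt D with hS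
  have hS0 : 0 ≤ S := Real.sqrt_nonneg _
  have hSS : S ^ 2 = D := Real.sq_sqrt hD0
  have hSabs : |A - g| ≤ S := by
    rw [← Real.sqrt_sq_eq_abs]
    exact Real.sqrt_le_sqrt (by nlinarith [sq_nonneg B])
  -- P' = A − λ₋, Q' = g − λ₋
  set P' := (A - g + S) / 2 with hP'
  set Q' := (g - A + S) / 2 with hQ'
  have hP'0 : 0 ≤ P' := by
    have := neg_abs_le (A - g)
    rw [hP']; linarith [le_abs_self (A - g), abs_nonneg (A - g)]
  have hQ'0 : 0 ≤ Q' := by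
    rw [hQ']; linarith [le_abs_self (A - g)]
  have hPQ : P' * Q' = B ^ 2 := by
    rw [hP', hQ']
    nlinarith [hSS]
  -- the claim is P' s² + Q' t² − 2 B s t ≥ 0
  have key : 0 ≤ P' * s ^ 2 + Q' * t ^ 2 - 2 * B * s * t := by
    by_cases h0 : P' + Q' = 0
    · have hP'z : P' = 0 := by linarith
      have hQ'z : Q' = 0 := by linarith
      have hBz : B = 0 := by
        have : B ^ 2 = 0 := by rw [← hPQ, hP'z]; ring
        exact pow_eq_zero_iff (two_ne_zero) |>.1 this
      rw [hP'z, hQ'z, hBz]; ring_nf; exact le_refl _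
    · have hpos : 0 < P' + Q' := lt_of_le_of_ne (by linarith) (Ne.symm h0)
      have hsos : (P' + Q') * (P' * s ^ 2 + Q' * t ^ 2 - 2 * B * s * t)
          = (P' * s - B * t) ^ 2 + (Q' * t - B * s) ^ 2 := by
        nlinarith [hPQ]
      have : 0 ≤ (P' + Q') * (P' * s ^ 2 + Q' * t ^ 2 - 2 * B * s * t) := by
        rw [hsos]; positivity
      exact nonneg_of_mul_nonneg_right (by rwa [mul_comm] at this) hpos |> fun h => by
        exact (mul_nonneg_iff_of_pos_left hpos).1 this
  have e : A * s ^ 2 + g * t ^ 2 - 2 * B * s * t - ((A + g) - S) / 2 * (s ^ 2 + t ^ 2)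
      = P' * s ^ 2 + Q' * t ^ 2 - 2 * B * s * t := by
    rw [hP', hQ']; ring
  linarith [key, e]

/-- Cauchy–Schwarz for `dot4`: `⟨f,g⟩² ≤ ⟨f,f⟩⟨g,g⟩`. -/
theorem dot4_sq_le (f g : Fin 4 → ℝ) : dot4 f g ^ 2 ≤ dot4 f f * dot4 g g := by
  have h := Finset.sum_mul_sq_le_sq_mul_sq Finset.univ f g
  simp only [dot4]
  have e1 : ∑ i, f i * f i = ∑ i, f i ^ 2 := by simp [pow_two]
  have e2 : ∑ i, g i * g i = ∑ i, g i ^ 2 := by simp [pow_two]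
  rw [e1, e2]
  exact h

/-- `|⟨f,g⟩| ≤ √⟨f,f⟩ · c` whenever `⟨g,g⟩ ≤ c²`, `0 ≤ c`. -/
theorem abs_dot4_le (f g : Fin 4 → ℝ) (c : ℝ) (hc : 0 ≤ c) (hg : dot4 g g ≤ c ^ 2) :
    |dot4 f g| ≤ Real.sqrt (dot4 f f) * c := by
  have hff : 0 ≤ dot4 f f := by
    simp only [dot4]; exact Finset.sum_nonneg (fun i _ => mul_self_nonneg _)
  have h1 := dot4_sq_le f g
  have h2 : dot4 f g ^ 2 ≤ (Real.sqrt (dot4 f f) * c) ^ 2 := by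
    rw [mul_pow, Real.sq_sqrt hff]
    exact le_trans h1 (mul_le_mul_of_nonneg_left hg hff)
  have h3 : 0 ≤ Real.sqrt (dot4 f f) * c := mul_nonneg (Real.sqrt_nonneg _) hc
  exact abs_le_of_sq_le_sq' h2 h3 |> fun h => abs_le.2 h

/-- ★ THE COMPRESSION BOUND (memo §327(e)) holds. -/
theorem compressionBound_holds : CompressionBound := by
  intro P x ρ g res xp hP hρ hres hxp hg hres2 hxp2 v
  dsimp only at hres2 hxp2 ⊢
  -- symmetric entries
  have hs : ∀ i j, P j i = P i j := fun i j => hP.apply i j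
  -- names
  set η := dot4 uHalf (P.mulVec uHalf) with hη
  set a := dot4 uHalf x with ha
  set α := dot4 uHalf v with hα
  set w : Fin 4 → ℝ := fun i => v i - α * uHalf i with hw
  set r : Fin 4 → ℝ := fun i => P.mulVec uHalf i - η * uHalf i with hr
  set xo : Fin 4 → ℝ := fun i => x i - a * uHalf i with hxo
  set c := dot4 w r with hc
  set t := dot4 xo w with ht
  set β := Real.sqrt (dot4 w w) with hβ
  have hww : 0 ≤ dot4 w w := by
    simp only [dot4]; exact Finset.sum_nonneg (fun i _ => mul_self_nonneg _)
  have hβ0 : 0 ≤ β := Real.sqrt_nonneg _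
  have hββ : β ^ 2 = dot4 w w := Real.sq_sqrt hww
  -- (I1) ‖v‖² = α² + ‖w‖²
  have I1 : dot4 v v = α ^ 2 + dot4 w w := by
    simp only [hw, hα, dot4, uHalf, Fin.sum_univ_four]
    ring
  -- (I4) w ⊥ u
  have I4 : dot4 uHalf w = 0 := by
    simp only [hw, hα, dot4, uHalf, Fin.sum_univ_four]
    ring
  -- (I2) ⟨v,Pv⟩ = α²η + 2αc + ⟨w,Pw⟩  (uses symmetry)
  have I2 : dot4 v (P.mulVec v) = α ^ 2 * η + 2 * α * c + dot4 w (P.mulVec w) := by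
    simp only [hc, hw, hr, hη, hα, dot4, uHalf, Matrix.mulVec, dotProduct, Fin.sum_univ_four,
      hs 0 1, hs 0 2, hs 0 3, hs 1 2, hs 1 3, hs 2 3]
    ring
  -- (I3) ⟨x,v⟩ = aα + t
  have I3 : dot4 x v = a * α + t := by
    simp only [ht, hxo, hw, ha, hα, dot4, uHalf, Fin.sum_univ_four]
    ring
  -- Cauchy–Schwarz bounds on the cross terms
  have Cc : |c| ≤ β * res := by
    have := abs_dot4_le w r res hres hres2
    simpa [hc, hβ] using this
  have Ct : |t| ≤ β * xp := by
    have h1 : dot4 xo xo ≤ xp ^ 2 := le_of_eq hxp2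
    have := abs_dot4_le w xo xp hxp h1
    have hsym : dot4 w xo = dot4 xo w := by
      simp only [dot4]; exact Finset.sum_congr rfl (fun i _ => mul_comm _ _)
    rw [hsym] at this
    simpa [ht, hβ] using this
  -- ⟨w,Pw⟩ ≥ g ‖w‖²
  have Gw : g * dot4 w w ≤ dot4 w (P.mulVec w) := hg w I4
  -- lower bounds for the cross terms
  have L1 : -(2 * |α| * (β * res)) ≤ 2 * α * c := by
    have h1 : |2 * α * c| = 2 * |α| * |c| := by
      rw [abs_mul, abs_mul, abs_two]
    have h2 : 2 * |α| * |c| ≤ 2 * |α| * (β * res) :=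
      mul_le_mul_of_nonneg_left Cc (by positivity)
    have h3 := neg_abs_le (2 * α * c)
    linarith
  have L2 : ρ * (a ^ 2 * α ^ 2 - 2 * (|a| * |α|) * (β * xp)) ≤ ρ * (a * α + t) ^ 2 := by
    apply mul_le_mul_of_nonneg_left _ hρ
    have h1 : |2 * (a * α) * t| = 2 * (|a| * |α|) * |t| := by
      rw [abs_mul, abs_mul, abs_mul, abs_two]
    have h2 : 2 * (|a| * |α|) * |t| ≤ 2 * (|a| * |α|) * (β * xp) :=
      mul_le_mul_of_nonneg_left Ct (by positivity)
    have h3 := neg_abs_le (2 * (a * α) * t)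
    nlinarith [sq_nonneg t]
  -- the 2×2 step with s = |α|, t = β
  have T := two_by_two_lower (η + ρ * a ^ 2) g (ρ * |a| * xp + res) |α| β
  have hαα : |α| ^ 2 = α ^ 2 := sq_abs α
  rw [hαα, hββ] at T
  -- assemble
  rw [I1, I2, I3]
  have : (η + ρ * a ^ 2) * α ^ 2 + g * dot4 w w - 2 * (ρ * |a| * xp + res) * |α| * β
      ≤ α ^ 2 * η + 2 * α * c + dot4 w (P.mulVec w) + ρ * (a * α + t) ^ 2 := by
    nlinarith [L1, L2, Gw]
  linarith [T, this]

end TwoChannel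

end Summit.HubbardSuperconductivity.HubbardSuperconductivity.Theorems.AnisotropyChord.Transfer.Fibre3
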